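import Literature.Analysis.FluidPDE.CriticalSpaces
import HarnessLib

/-!
# Almost periodicity modulo symmetries (Kenig–Merle critical elements for Navier–Stokes)

Trunk T-FLUID (Literature/Analysis/FluidPDE); definition request `wi-03422`
(`Literature.Analysis.FluidPDE.IsAlmostPeriodicModSymm`, route NavierStokesRegularity/MinimalBlowupRigidity).

In the Kenig–Merle road map (concentration–compactness + rigidity), transplanted to the
Navier–Stokes equations in the critical space `Ḣ^{1/2}(ℝ³)` by Kenig–Koch (2011) and to `L³` /
critical Besov spaces by Gallagher–Koch–Planchon (2013, 2016), a *critical element* is a solution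
whose orbit is precompact in the critical space **modulo the non-compact symmetries** of the
equation — for Navier–Stokes data: space translations `u₀ ↦ u₀(· + x₀)` and the scaling
`u₀ ↦ λ u₀(λ ·)` (`Literature.Analysis.FluidPDE.rescaleData`). This file defines that property for a space–time field
`u : ℝ → ℝ³ → ℝ³` on a time set `S`:

`IsAlmostPeriodicModSymm S u` : there are modulation parameters `λ : ℝ → ℝ_{>0}`,
`x₀ : ℝ → ℝ³` such that every modulated slice `λ(t) u(t, λ(t)x + x₀(t))`… precisely
`rescaleData (λ t) (u t (· + x₀ t))`, `t ∈ S`, lies in `Ḣ^{1/2}` (through the tree's bridge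
`Literature.Analysis.FunctionSpaces.MemHomSobolev`/`Literature.Analysis.FunctionSpaces.HomSobolev.ofFun` applied to the complexified field), and the set of
their `Ḣ^{1/2}`-classes has compact closure in the bundled space `Literature.HomSobolev ℝ³ ℂ³ (1/2)`.

## Sources

* C. E. Kenig, G. S. Koch, *An alternative approach to regularity for the Navier–Stokes equations
  in critical spaces*, Ann. IHP (C) 28 (2011) 159–187 (arXiv:0908.3349), §1 (critical element,
  compactness modulo scaling and translations, following Kenig–Merle).
* I. Gallagher, G. S. Koch, F. Planchon, Math. Ann. 355 (2013) 1527–1559 (arXiv:1012.0145), §1;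
  and CMP 343 (2016) (`GKP2016`).
* H. Bahouri, J.-Y. Chemin, R. Danchin, *Fourier analysis and nonlinear PDE* (2011), Def. 1.31
  (`Ḣ^s`).

## Design choices

* The tree's `HomSobolev E F s` is the Fourier-side realisation of `Ḣ^s` and its bridge from
  functions, `HomSobolev.ofFun f (hf : MemHomSobolev s f)`, needs `f ∈ Ḣ^s ∩ L²`; accordingly the
  predicate carries the membership proofs `hmem t ht` as part of the existential data (requested:
  "viewed in `Ḣ^{1/2}` via `HomSobolev.ofFun`"). Real vector fields enter through
  `EuclideanSpace.complexify`, as everywhere in `CriticalSpaces.lean`.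
* The modulation is "translate, then rescale": `x ↦ λ u(t, λ x + x₀)`; the other order differs by
  reparametrising `x₀`, immaterial under `∃ x₀`. `λ t > 0` is only required for `t ∈ S`.
* Compact closure is Mathlib's `IsCompact (closure K)` in the (complete) normed space
  `HomSobolev`, i.e. `K` is totally bounded.
-/

noncomputable section

open Set

namespace Literature.Analysis.FluidPDE

open FunctionSpaces.EuclideanSpace (complexify)

local notation "ℝ³" => EuclideanSpace ℝ (Fin 3)
local notation "ℂ³" => EuclideanSpace ℂ (Fin 3)

/-- The slice of `u` at time `t` modulated by the Navier–Stokes symmetries with parameters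
`λ, x₀`: `x ↦ λ · u(t, λ x + x₀)` (`rescaleData λ` of the translate `u(t, · + x₀)`).
[Kenig–Koch 2011, §1 (scaling and translation symmetries of NS in `Ḣ^{1/2}`)] [cite: KenigKoch2011, §1] -/
def modulatedSlice (lam : ℝ) (x₀ : ℝ³) (u : ℝ → ℝ³ → ℝ³) (t : ℝ) : ℝ³ → ℝ³ :=
  rescaleData lam fun x => u t (x + x₀)

/-- Unfolding `modulatedSlice`. [Kenig–Koch 2011, §1] [folklore] -/
@[simp] theorem modulatedSlice_apply (lam : ℝ) (x₀ : ℝ³) (u : ℝ → ℝ³ → ℝ³) (t : ℝ) (x : ℝ³) :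
    modulatedSlice lam x₀ u t x = lam • u t (lam • x + x₀) := rfl

/-- **Almost periodicity modulo symmetries** (Kenig–Merle critical-element property for
Navier–Stokes in `Ḣ^{1/2}`): there are `λ : ℝ → ℝ`, positive on `S`, and `x₀ : ℝ → ℝ³` such
that each modulated slice `λ(t) u(t, λ(t)· + x₀(t))`, `t ∈ S`, lies in `Ḣ^{1/2} ∩ L²` (after
complexification) and the set of their classes in `Ḣ^{1/2}` has compact closure.
[Kenig–Koch 2011, §1 ("compactness modulo symmetries" of the critical element);
Gallagher–Koch–Planchon 2013, §1; Bahouri–Chemin–Danchin 2011, Def. 1.31] [cite: KenigKoch2011, §1] -/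
def IsAlmostPeriodicModSymm (S : Set ℝ) (u : ℝ → ℝ³ → ℝ³) : Prop :=
  ∃ (lam : ℝ → ℝ) (x₀ : ℝ → ℝ³) (_hlam : ∀ t ∈ S, 0 < lam t)
    (hmem : ∀ t ∈ S, FunctionSpaces.MemHomSobolev (1 / 2 : ℝ) (complexify ∘ modulatedSlice (lam t) (x₀ t) u t)),
    IsCompact (closure {v : FunctionSpaces.HomSobolev ℝ³ ℂ³ (1 / 2 : ℝ) |
      ∃ (t : ℝ) (ht : t ∈ S), v = FunctionSpaces.HomSobolev.ofFun _ (hmem t ht)})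

/-! ### API -/

/-- On the empty time set every field is (vacuously) almost periodic modulo symmetries.
[folklore] -/
theorem isAlmostPeriodicModSymm_empty (u : ℝ → ℝ³ → ℝ³) : IsAlmostPeriodicModSymm ∅ u := by
  refine ⟨fun _ => 1, fun _ => 0, fun t ht => absurd ht (Set.notMem_empty t),
    fun t ht => absurd ht (Set.notMem_empty t), ?_⟩
  convert isCompact_empty (X := FunctionSpaces.HomSobolev ℝ³ ℂ³ (1 / 2 : ℝ))
  rw [closure_empty_iff, Set.eq_empty_iff_forall_notMem]
  rintro v ⟨t, ht, -⟩
  exact ht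

/-- Monotonicity in the time set. [Kenig–Koch 2011, §1] [folklore] -/
theorem IsAlmostPeriodicModSymm.mono {S T : Set ℝ} {u : ℝ → ℝ³ → ℝ³}
    (h : IsAlmostPeriodicModSymm T u) (hST : S ⊆ T) : IsAlmostPeriodicModSymm S u := by
  obtain ⟨lam, x₀, hlam, hmem, hK⟩ := h
  refine ⟨lam, x₀, fun t ht => hlam t (hST ht), fun t ht => hmem t (hST ht), ?_⟩
  refine hK.of_isClosed_subset isClosed_closure (closure_mono ?_)
  rintro v ⟨t, ht, rfl⟩
  exact ⟨t, hST ht, rfl⟩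

end Literature.Analysis.FluidPDE
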